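import Summits.QuantumFields.YangMills.Theorems.BalabanUVNodesN07PointFeasibilityOneLevelSymbol
import HarnessLib

/-!
# DAG node N07 [B11], road R0′ — LEMMA (P) ONE LEVEL, file 3∕3: «a fine scalar `μ` CONSTANT ON THE BLOCK CENTRES with `R∂*∂μ = 0` is constant»
# on the torus `T_η = Tor (fine n M)`, blocks of ODD side `n = 2c₀+1`, every `d`, every unit torus — the one-level half of the R0′-native junction `hker`

Cell `pub-ymgap` (HUMAN RULINGS D-0062 ∕ D-0149 ∕ D-0154), width seat `pub-ymgap-dag-n07-w5` g0′, 2026-08-28.  `--kind proof --supports <K1 key> --as helper`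
(count-neutral; CLAIM-1 cell bus 08:40Z, lane owner dag-n07-e g20 GO 08:46Z «inert under road (a); located-research insurance for the R0′-native junction»).
Step 5 (assembly) of dag-n07-e's `LOCATED-POINT-FEASIBILITY.md`; files 1∕3–2∕3 supply the Fourier bookkeeping and `K(p′) ≠ 0`.

THE PRINT.  [B5] = T. Bałaban, *Propagators and renormalization transformations for lattice gauge theories. I*, Commun. Math. Phys. **95** (1984)
17–40 `[Balaban1984PropagatorsI]`: (1.6) p. 18 (blocks), (1.20) p. 20 (`Q′_k`), (1.29)–(1.31) p. 23 («p = p′ + l», `u_k(p) = Π_μ ∂¹_μ(p′)∕∂_μ(p)`,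
«u_k(l) = 0 for l ≠ 0»), p. 25 («R … an orthogonal projection on the linear subspace ΔN(Q′_k)»), (1.69)–(1.70) pp. 29–30; [B6] = CMP **96**
(1984) 223–250 `[Balaban1984PropagatorsII]`, (2.10)–(2.12) p. 225, (2.22) p. 226, (2.35) p. 228 («The only assumption we have used was the
positivity of the operator Δ_a»); [I] = CMP **109** (1987) 249–301 `[Balaban1987RG1]`, (0.4) p. 253 (the averaging of record: block CENTRES, odd `L`).

WHY (road R0′ of record, dag-n07-e `LOCATED-POINT-FEASIBILITY.md`, 2026-08-28).  At the record the (0.4) average intertwines fine gradients with the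
coarse gradient of the CENTRE VALUES (`Q_j(1)(∂φ) = ∂_c(φ∘embIter j)`), not with the block means behind `R`; the feasibility of the admissible pure gauge
on road R0′ (`N07FlatHFeasibility.exists_admissible_grad_of_flatKernel`, hypothesis `hker`) is then the lattice lemma
(P) «μ constant on the block centres ∧ R∂*∂μ = 0 ⇒ ∂μ = 0», which print's matched letters never need ([B6] (2.22) is about block means).

WHAT THIS FILE DOES (§5).
* ★★ `dft_eq_zero_of_biharmonic_of_centres` — odd `n = 2c₀+1`, `Δ²μ = Q′ᴴβ`, `μ` constant on the centres `ny + c₀` ⇒ `μ̂(p) = 0` for all `p ≠ 0`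
  (fibre `p′ = 0`: «u(l) = 0 for l ≠ 0»; fibre `p′ ≠ 0`: the centre samples kill the coarse mode, the biharmonic equation makes `μ̂(p′+l) ∝ β̂(p′)` with the
  centred aliasing weights, and `K(p′) ≠ 0`); `eq_const_of_dft_eq_zero`; ★★★ `eq_const_of_biharmonic_of_centres` ((P), biharmonic form).
* `exists_biharmonic_of_RT_LapS_eq_zero` (`R(Δμ) = 0 ⇒ Δ²μ = Q′ᴴβ`, `R = RT = 1 − P − P_const` of `B5Identities197Torus`, via `B5Value126.PcT_mulVec`,
  `B5LaplaceInverse.LapS_mul_LapSinv ∕ Pker_orth ∕ Pker_const`); ★★★ `pointFeasibility_oneLevel` (centres constant ∧ `RT (Δμ) = 0` ⇒ `GradOp μ = 0` — the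
  `hker` shape of `N07FlatHFeasibility` on the FN carrier at one level); `eq_const_of_centres_of_RT_LapS_eq_zero`; A6 non-vacuity
  `pointFeasibility_oneLevel_hypotheses_const`.

HONEST FRAMING (binding).  Count-neutral helper typed on the b05 owner's torus `Tor (fine n M)` (carrier FN), ONE averaging level (block side `n` odd,
true centres `ny + c₀`, `2c₀ + 1 = n`), every `d`, every unit torus `M`; finite Fourier analysis + trigonometry only.  It asserts NOTHING of
[B11]∕[B6]∕[3]'s analysis; the MULTI-LEVEL lemma `(P)_D` for a nested family `D` (the record's heart family `Node00.cubeDomains`) is NOT proved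
here and remains OPEN (dag-n07-w7's `LOCATED-PD-TILE-CRITERION.md` holds the located evidence); under road (a) of the K0 lineage (k0-s1-w1) `(P)` is
not consumed — this is located-research insurance for the R0′-native junction.  The V1 ∕ record reading needs r03's transports
(`B6ProjR212TorusBridge.RE_bridge` for `R`, `B5Eq147TorusBridge.Lap_tS` ∕ `B5HkOpLandauMin.LapS_towerE` for `Δ`, and the images of the centres) and is
NOT in this file.  `hker` ∕ stub 1 ∕ K0⁷ ∕ K1⁸ NOT closed; N07 NOT discharged; counts unmoved; no summit statement is proved by this seat — R4 closes the
conditional finite-𝕋⁴ rung `BalabanLadder.UV` only; nothing continuum ∕ ℝ⁴ ∕ OS ∕ mass gap ∕ Clay.  No `sorry`, no `def`, no `instance`, no `notation`.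
-/

noncomputable section

open scoped BigOperators Matrix ComplexConjugate
open Finset Complex

namespace Summit.QuantumFields.YangMills.BalabanUVNodes.N07PointFeasibilityOneLevel

open Literature.MathematicalPhysics.QuantumFieldTheory.Balaban1983to89
open B5Prop11Plancherel (Tor chi dft fine sOf chi_add_right chi_zero_left sum_chi conj_chi)
open B5Block118 (cT dft_apply' conj_dft dft_inversion sum_conj_chi_mul_chi up iota bpt pOf pOf_bijective
  pOf_injective om chi_pOf_up chi_pOf_iota avg_om sum_chi_iota uSym_sOf_zero QsOp QsOp_mulVec)
open B5Blocks16 (bpt_bijective bpt_injective sum_blocks)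
open B5Prop11Fiber (dSym d1Sym vSym uSym dSym_eq_zero_iff)
open B5Action121 (LapS GradOp sdiff sdiff_mulVec GradOp_mulVec)
open B5LaplaceInverse (lsym ssym Pker LapSinv)
open B5Momentum130 (dft_LapS_apply lsym_eq_zero_iff dft_zero_apply)
open B5Momentum133 (ssym_pOf lsym_pOf lsym_pOf_ne_zero)
open B5FiberZero (pOf_zero)
open B5Identities197Torus (RT)
open Summit.QuantumFields.YangMills.Theorems.N07AliasSumPositivity (aliasSymbolK_pos)

/-! ## §5  LEMMA (P), ONE LEVEL: centre values constant ∧ biharmonic block-constancy ⇒ constant; the `R∂*∂` (= `hker`) form -/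

section Main

variable {d : ℕ} (n : ℕ) [NeZero n] (M : Fin d → ℕ) [hM : ∀ μ, NeZero (M μ)]

/-- **All non-zero Fourier modes vanish.**  Let `n = 2c₀+1` be odd, `μ : T_η → ℂ` with `Δ²μ = Q′ᴴβ` for some coarse `β` («`Δ²μ` is
block-constant», i.e. `R(Δμ) = 0` up to the zero mode) and `μ` CONSTANT ON THE BLOCK CENTRES `ny + c₀`.  Then `μ̂(p) = 0` for every `p ≠ 0`:
on the fibre `p′ = 0` because `u(l) = 0` for `l ≠ 0`; on a fibre `p′ ≠ 0` because the centre samples kill the coarse mode `p′`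
(`alias_sum_eq_zero_of_sample_const`), the biharmonic equation makes every `μ̂(p′+l)` proportional to `β̂(p′)` with the centred
aliasing weights, and their sum `K(p′) ≠ 0` (`centreSymbol_ne_zero`). [cite: Balaban1984PropagatorsI, (1.30)-(1.31) p.23; Balaban1987RG1, (0.4) p.253] -/
theorem dft_eq_zero_of_biharmonic_of_centres (c₀ : Fin d → Fin n) (hc₀ : ∀ ν, 2 * (c₀ ν : ℕ) + 1 = n)
    (μ : Tor (fine n M) → ℂ) (β : Tor M → ℂ)
    (hbi : LapS (fine n M) (n : ℂ) *ᵥ (LapS (fine n M) (n : ℂ) *ᵥ μ) = (QsOp n M)ᴴ *ᵥ β)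
    (hctr : ∀ y, μ (bpt n M y c₀) = μ (bpt n M 0 c₀)) {p : Tor (fine n M)} (hp : p ≠ 0) :
    (dft (fine n M) *ᵥ μ) p = 0 := by
  have hnc : (n : ℂ) ≠ 0 := by exact_mod_cast NeZero.ne n
  have hn1 : 1 ≤ n := Nat.one_le_iff_ne_zero.mpr (NeZero.ne n)
  obtain ⟨⟨k, q⟩, rfl⟩ := (pOf_bijective n M).2 p
  -- the biharmonic equation on the fibre of `q`
  have hfib : ∀ k' : Fin d → Fin n,
      lsym (fine n M) (n : ℂ) (pOf n M (k', q)) ^ 2 * (dft (fine n M) *ᵥ μ) (pOf n M (k', q))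
        = (cT (fine n M) : ℂ) * conj (uSym n k' (sOf M q)) * ∑ y, conj (chi M q y) * β y := by
    intro k'
    rw [← dft_LapS_LapS_apply, hbi, dft_QsOp_conjTranspose_apply]
  have hl : lsym (fine n M) (n : ℂ) (pOf n M (k, q)) ≠ 0 := fun h0 => hp ((lsym_eq_zero_iff (fine n M) hnc _).mp h0)
  by_cases hq : q = 0
  · subst hq
    have hk : k ≠ 0 := by
      rintro rfl
      exact hp (pOf_zero n M)
    have h := hfib k
    rw [uSym_sOf_zero, if_neg hk, map_zero, mul_zero, zero_mul] at h
    exact (mul_eq_zero.mp h).resolve_left (pow_ne_zero 2 hl)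
  · -- the coarse mode `q` of the centre samples vanishes
    have hS := alias_sum_eq_zero_of_sample_const n M μ c₀ hctr hq
    have hB : ∑ y, conj (chi M q y) * β y = 0 := by
      have hrepr : ∀ k' : Fin d → Fin n, (dft (fine n M) *ᵥ μ) (pOf n M (k', q))
          = (cT (fine n M) : ℂ) * (∑ y, conj (chi M q y) * β y) *
            (conj (uSym n k' (sOf M q)) / lsym (fine n M) (n : ℂ) (pOf n M (k', q)) ^ 2) := by
        intro k'
        have hl' : lsym (fine n M) (n : ℂ) (pOf n M (k', q)) ≠ 0 := lsym_pOf_ne_zero n M (n : ℂ) hnc k' hq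
        field_simp
        rw [mul_comm]  -- adjust
        linear_combination hfib k'
      simp_rw [hrepr] at hS
      have hS' : (cT (fine n M) : ℂ) * (∑ y, conj (chi M q y) * β y) *
          ∑ k' : Fin d → Fin n, chi (fine n M) (pOf n M (k', q)) (iota n M c₀) * conj (uSym n k' (sOf M q)) /
            lsym (fine n M) (n : ℂ) (pOf n M (k', q)) ^ 2 = 0 := by
        rw [Finset.mul_sum, ← hS]
        refine Finset.sum_congr rfl fun k' _ => ?_
        ring
      have hc : (cT (fine n M) : ℂ) ≠ 0 := by exact_mod_cast (cT_pos (fine n M)).ne'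
      have hK := centreSymbol_ne_zero n M c₀ hc₀ hq
      rcases mul_eq_zero.mp hS' with h1 | h1
      · exact (mul_eq_zero.mp h1).resolve_left hc
      · exact absurd h1 hK
    have h := hfib k
    rw [hB, mul_zero] at h
    exact (mul_eq_zero.mp h).resolve_left (pow_ne_zero 2 hl)

/-- A function on the torus all of whose non-zero Fourier modes vanish is constant (Fourier inversion). [folklore] -/
theorem eq_const_of_dft_eq_zero (μ : Tor (fine n M) → ℂ) (h : ∀ p : Tor (fine n M), p ≠ 0 → (dft (fine n M) *ᵥ μ) p = 0)
    (x : Tor (fine n M)) : μ x = μ 0 := by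
  have hx : ∀ z : Tor (fine n M), μ z = (cT (fine n M) : ℂ) * (dft (fine n M) *ᵥ μ) 0 := by
    intro z
    rw [dft_inversion (fine n M) μ z, Finset.sum_eq_single (0 : Tor (fine n M))]
    · rw [conj_dft, chi_zero_left, mul_one]
    · intro p _ hp
      rw [h p hp, mul_zero]
    · intro h0
      exact absurd (Finset.mem_univ _) h0
  rw [hx x, hx 0]

/-- ★★★ **LEMMA (P), ONE LEVEL, biharmonic form.**  On the torus `T_η = Tor (fine n M)` with blocks of ODD side `n = 2c₀+1` (the `k`-fold
(0.4) blocks, `n = L^k`, `L` odd) and centres `ny + c₀`: if `Δ²μ = Q′ᴴβ` (i.e. `Δ²μ` is block-constant) and `μ` takes the SAME value at every block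
centre, then `μ` is constant.  (The «matched» statement with block MEANS instead of centre VALUES is immediate from `‖Δμ‖² = ⟨Q′μ, β⟩`; the point
version is the Fourier fact `K(p′) ≠ 0` of §4.)  The MULTI-LEVEL analogue for a nested domain family `D` (the record's `cubeDomains`) is NOT
proved here and remains OPEN. [cite: Balaban1984PropagatorsII, (2.10)-(2.12) p.225, (2.22) p.226; Balaban1987RG1, (0.4) p.253] -/
theorem eq_const_of_biharmonic_of_centres (c₀ : Fin d → Fin n) (hc₀ : ∀ ν, 2 * (c₀ ν : ℕ) + 1 = n)
    (μ : Tor (fine n M) → ℂ) (β : Tor M → ℂ)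
    (hbi : LapS (fine n M) (n : ℂ) *ᵥ (LapS (fine n M) (n : ℂ) *ᵥ μ) = (QsOp n M)ᴴ *ᵥ β)
    (hctr : ∀ y, μ (bpt n M y c₀) = μ (bpt n M 0 c₀)) (x : Tor (fine n M)) : μ x = μ 0 :=
  eq_const_of_dft_eq_zero n M μ (fun _ hp => dft_eq_zero_of_biharmonic_of_centres n M c₀ hc₀ μ β hbi hctr hp) x

/-- `R(Δμ) = 0 ⇒ Δ²μ = Q′ᴴβ` for some coarse `β`: with `R = 1 − P − P_const` ([B5] p. 25 ∕ (1.70); `P = Δ⁻¹Q′ᴴ(Q′Δ⁻²Q′ᴴ)⁻¹Q′Δ⁻¹`), `Δμ ⊥ 1` kills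
`P_const`, so `Δμ = P(Δμ) = Δ⁻¹Q′ᴴγ` and `Δ²μ = Q′ᴴγ − P_const(Q′ᴴγ) = Q′ᴴ(γ − const)` (a constant is `Q′ᴴ` of a constant).
[cite: Balaban1984PropagatorsI, p.25, (1.69)-(1.70) pp.29-30; Balaban1984PropagatorsII, (2.10)-(2.12) p.225] -/
theorem exists_biharmonic_of_RT_LapS_eq_zero (μ : Tor (fine n M) → ℂ)
    (hR : RT n M *ᵥ (LapS (fine n M) (n : ℂ) *ᵥ μ) = 0) :
    ∃ β : Tor M → ℂ, LapS (fine n M) (n : ℂ) *ᵥ (LapS (fine n M) (n : ℂ) *ᵥ μ) = (QsOp n M)ᴴ *ᵥ β := by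
  have hnc : (n : ℂ) ≠ 0 := by exact_mod_cast NeZero.ne n
  set w := LapS (fine n M) (n : ℂ) *ᵥ μ with hw
  have hw0 : ∑ x, w x = 0 := B5DivOrth.sum_LapS (fine n M) (n : ℂ) μ
  have hPk : Pker (fine n M) (n : ℂ) *ᵥ w = 0 := B5LaplaceInverse.Pker_orth (fine n M) hnc w hw0
  -- `w = P w`
  set γ := B5Substitution125.Minv n M (n : ℂ) *ᵥ (QsOp n M *ᵥ (LapSinv (fine n M) (n : ℂ) *ᵥ w)) with hγ
  have hPw : w = LapSinv (fine n M) (n : ℂ) *ᵥ ((QsOp n M)ᴴ *ᵥ γ) := by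
    have h1 : RT n M *ᵥ w = w - B5Value126.PcT n M (n : ℂ) *ᵥ w - Pker (fine n M) (n : ℂ) *ᵥ w := by
      rw [RT, Matrix.sub_mulVec, Matrix.sub_mulVec, Matrix.one_mulVec]
    rw [hR, hPk, sub_zero] at h1
    have h2 : w = B5Value126.PcT n M (n : ℂ) *ᵥ w := (sub_eq_zero.mp h1.symm)
    rw [B5Value126.PcT_mulVec] at h2
    exact h2
  -- apply `Δ`: `Δ w = (1 − P_const)(Q′ᴴ γ)`
  have hLw : LapS (fine n M) (n : ℂ) *ᵥ w
      = (QsOp n M)ᴴ *ᵥ γ - Pker (fine n M) (n : ℂ) *ᵥ ((QsOp n M)ᴴ *ᵥ γ) := by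
    conv_lhs => rw [hPw]
    rw [Matrix.mulVec_mulVec, B5LaplaceInverse.LapS_mul_LapSinv, Matrix.sub_mulVec, Matrix.one_mulVec]
  -- the constant `P_const(Q′ᴴγ)` is `Q′ᴴ` of a constant
  set κ₀ : ℂ := (Pker (fine n M) (n : ℂ) *ᵥ ((QsOp n M)ᴴ *ᵥ γ)) 0 with hκ₀
  have hconst : Pker (fine n M) (n : ℂ) *ᵥ ((QsOp n M)ᴴ *ᵥ γ) = (QsOp n M)ᴴ *ᵥ (fun _ => (n : ℂ) ^ d * κ₀) := by
    funext x
    obtain ⟨⟨y, j⟩, rfl⟩ := (bpt_bijective n M).2 x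
    rw [B5LaplaceInverse.Pker_const (fine n M) hnc, QsOp_conjTranspose_mulVec_bpt, ← hκ₀]
    field_simp
  refine ⟨γ - fun _ => (n : ℂ) ^ d * κ₀, ?_⟩
  rw [Matrix.mulVec_sub, ← hconst, ← hLw]

/-- ★★★ **LEMMA (P), ONE LEVEL — the `hker` letter of road R0′ at a one-level family**: on `T_η = Tor (fine n M)` with ODD block side
`n = 2c₀+1`, a fine scalar `μ` that is CONSTANT ON THE BLOCK CENTRES `ny + c₀` and satisfies `R∂*∂μ = 0` (`R = RT` = the orthogonal projection onto
`ΔN(Q′)` of [B5] p. 25 = V1's `RE` at one level by r03's `B6ProjR212TorusBridge.RE_bridge`) is CONSTANT, hence a trivial pure gauge: `∂μ = 0`.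
This is the shape `∀ μ, ∂_c(Eμ) = 0 → R∂*∂μ = 0 → ∂μ = 0` consumed by `N07FlatHFeasibility.exists_admissible_grad_of_flatKernel` when the coarse map `E` is
EVALUATION AT THE CENTRES (the (0.4) record: `Q_j(1)(∂φ) = ∂_c(φ∘embIter j)`), read on the FN carrier; `∂_c(Eμ) = 0` = «centre values constant» on the
connected unit torus.  HONEST: one level only; the multi-level `(P)_D` is OPEN. [cite: Balaban1984PropagatorsII, (2.22) p.226, (2.35) p.228; Balaban1987RG1, (0.4) p.253] -/
theorem pointFeasibility_oneLevel (c₀ : Fin d → Fin n) (hc₀ : ∀ ν, 2 * (c₀ ν : ℕ) + 1 = n) (μ : Tor (fine n M) → ℂ)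
    (hctr : ∀ y, μ (bpt n M y c₀) = μ (bpt n M 0 c₀))
    (hR : RT n M *ᵥ (LapS (fine n M) (n : ℂ) *ᵥ μ) = 0) :
    GradOp (fine n M) (n : ℂ) *ᵥ μ = 0 := by
  obtain ⟨β, hbi⟩ := exists_biharmonic_of_RT_LapS_eq_zero n M μ hR
  have hconst := eq_const_of_biharmonic_of_centres n M c₀ hc₀ μ β hbi hctr
  funext i
  obtain ⟨x, ν⟩ := i
  rw [GradOp_mulVec, sdiff_mulVec, hconst (x + _), hconst x, sub_self, mul_zero, Pi.zero_apply]

/-- The same with the conclusion «`μ` is constant». [cite: Balaban1984PropagatorsII, (2.22) p.226; Balaban1987RG1, (0.4) p.253] -/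
theorem eq_const_of_centres_of_RT_LapS_eq_zero (c₀ : Fin d → Fin n) (hc₀ : ∀ ν, 2 * (c₀ ν : ℕ) + 1 = n)
    (μ : Tor (fine n M) → ℂ) (hctr : ∀ y, μ (bpt n M y c₀) = μ (bpt n M 0 c₀))
    (hR : RT n M *ᵥ (LapS (fine n M) (n : ℂ) *ᵥ μ) = 0) (x : Tor (fine n M)) : μ x = μ 0 := by
  obtain ⟨β, hbi⟩ := exists_biharmonic_of_RT_LapS_eq_zero n M μ hR
  exact eq_const_of_biharmonic_of_centres n M c₀ hc₀ μ β hbi hctr x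

/-- A6 non-vacuity: the hypotheses of `pointFeasibility_oneLevel` are inhabited (by the constants), and an odd `n` admits the centre `c₀ = (n−1)∕2`.
[folklore] -/
theorem pointFeasibility_oneLevel_hypotheses_const (a : ℂ) (c₀ : Fin d → Fin n) :
    (∀ y : Tor M, (fun _ : Tor (fine n M) => a) (bpt n M y c₀) = (fun _ : Tor (fine n M) => a) (bpt n M 0 c₀)) ∧
      RT n M *ᵥ (LapS (fine n M) (n : ℂ) *ᵥ (fun _ : Tor (fine n M) => a)) = 0 := by
  refine ⟨fun _ => rfl, ?_⟩
  have h0 : LapS (fine n M) (n : ℂ) *ᵥ (fun _ : Tor (fine n M) => a) = 0 := by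
    funext x
    rw [B5Action121.LapS_mulVec]
    have h2 : (2 : ℂ) * a - a - a = 0 := by ring
    simp [h2]
  rw [h0, Matrix.mulVec_zero]

end Main

end Summit.QuantumFields.YangMills.BalabanUVNodes.N07PointFeasibilityOneLevel

end
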